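import Literature.NumberTheory.Sieve.PolynomialValuesSieveSequence
import Literature.NumberTheory.Sieve.PolynomialCongruencesMeanValues
import Literature.NumberTheory.Sieve.IwaniecAlmostPrimesQuadraticMertens
import HarnessLib

/-!
# The ℓ¹ level of distribution of an irreducible quadratic sequence is exactly `x^{1/2}` — PROVED

Solo seat `solo-Parity-blind` (summit `Parity`, conjunct `BatemanHorn`): the calibration lemma
(C1) of the seat's report `run/shared/lean/ideation/Parity/solo-blind/paper/paper.md`, §1.

For the values `f(n)`, `1 ≤ n ≤ N`, of an integer polynomial — the tree's sifted sequence
`polyAPSeq f N 1 0` (`A_m(x) = #{n ≤ N : m ∣ f(n)}`, expected size `X = N`, density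
`g(m) = ρ_f(m)/m`, remainder `R_m = A_m − ρ_f(m) N/m`, with `ρ_f = polyRootCountMod ![f]`) — the
classical remainder bound `|R_m| ≤ ρ_f(m)` (`abs_remainder_polyAPSeq_le`) gives level of
distribution `N^{1−ε}`; in terms of the size `x ≍ N^{deg f}` of the members this is level
`x^{1/deg f − ε}` ("level of distribution `D` and degree `g` in the sense that `a ∈ 𝒜 ⇒ a < D^g`",
Greaves, *Sieves in Number Theory*, Ch. 5, Proposition 1, p. 135).  This file PROVES that in
the ℓ¹ sense nothing more is true, for the simplest reason: an INTEGER count `A_m ∈ ℕ` cannot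
approximate a main term `0 ≤ ρ_f(m)N/m ≤ 1/2` to better than the main term itself.

* `le_abs_natCast_sub` — `μ ≤ |A − μ|` for `A ∈ ℕ`, `0 ≤ μ`, `2μ ≤ 1`;
* `rootCount_mul_div_le_abs_remainder` — `ρ_f(m) N/m ≤ |R_m|` as soon as `2 ρ_f(m) N ≤ m`
  (any `f ∈ ℤ[X]`);
* `mul_sum_rootCount_div_le_sum_abs_remainder` — `N · ∑_{m ∈ S} ρ_f(m)/m ≤ ∑_{m ∈ S} |R_m|`
  over any finite set `S` of such moduli;
* `sum_abs_remainder_le_linear` — the UPPER half, assembled from the tree: for `f` irreducible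
  of positive degree, `∑_{1 ≤ m ≤ D} |R_m| ≤ C_f · D` (`D ≥ 2`; `abs_remainder_polyAPSeq_le` and
  the first moment `exists_sum_rootCount_le`), so level `N^{1−ε}` holds with room to spare;
* `quadratic_window` — for Iwaniec's quadratics `G = aX² + bX + c` (`a > 0`, `c` odd, `G`
  irreducible in `ℤ[X]`; e.g. `X² + 1`): if `|∑_{p ≤ t} ρ_G(p) log p/p − log t| ≤ C` for `t ≥ 1`
  (the tree's PROVED Mertens theorem `Iwaniec1978.rhoMertensStrongG` supplies such a `C`), then
  for `1 ≤ N`, `4N ≤ U ≤ V`:  `∑_{U < p ≤ V, p prime} |R_p| ≥ N · (log V − log U − 2C)/log V`;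
* `quadratic_level_le_half` — the headline: for every `ε > 0` there is `N₀` such that for all
  `N ≥ N₀`, every `V ≥ N^{1+ε}` and every admissible `x`,
  `∑_{4N < p ≤ V, p prime} |R_p(x)| ≥ (ε / (2(1+ε))) · N`;
* `X_sq_add_one_level_le_half` — the same for `f = X² + 1` with `x = N² + 1`.

Since `X = N`, the remainder sum up to level `D = N^{1+ε} = x^{(1+ε)/2}` is not `o(X)`, let
alone `O(X/(log X)^B)`: the sequence of values of an irreducible quadratic has ℓ¹ level of
distribution EXACTLY `x^{1/2}` (`N^{1−ε}` holds by `abs_remainder_polyAPSeq_le` and the tree's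
first-moment bound `exists_sum_rootCount_le`; `N^{1+ε}` fails already on the prime moduli).
Consequences drawn in the report, not formalised here: hypothesis (R) of Friedlander–Iwaniec's
asymptotic sieve for primes ((R1) needs `x^{2/3} < D`) and the level-`x^{1−ε}` hypothesis of
Bombieri's asymptotic sieve are false — not merely unproved — for these sequences; the Type I
information available for `n² + 1` is `γ = 1/2` in the normalisation of Ford–Maynard,
arXiv:2407.14368, §1.

Everything is stated over existing declarations of the tree (`polyAPSeq`, `apIndex`,
`SieveSequence.remainder`, `polyRootCountMod`, `Iwaniec1978.quadPoly`, `Iwaniec1978.rhoG`,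
`Iwaniec1978.rhoLogSumG`); no definition, no named fact, no `sorry`.

References.  G. Greaves, *Sieves in Number Theory*, Springer (2001), Ch. 5, p. 135
(`book:greavesnd-sieves-number-theory`, p. 135).  H. Iwaniec, *Almost-primes represented by
quadratic polynomials*, Invent. Math. 47 (1978) 171–188.  K. Ford, J. Maynard, *On the theory of
prime producing sieves*, arXiv:2407.14368 (2024), §1.
-/

noncomputable section

open Finset Real Polynomial
open Literature.NumberTheory.Sieve Literature.NumberTheory.Sieve.Iwaniec1978

namespace Summit.Parity.BatemanHorn.Theorems.SoloBlindLevel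

/-! ### An integer cannot approximate a small main term -/

/-- For `A ∈ ℕ` and `0 ≤ μ ≤ 1/2`: `μ ≤ |A − μ|` (if `A = 0` the error is `μ`; if `A ≥ 1` it is
`≥ 1 − μ ≥ μ`). -/
theorem le_abs_natCast_sub (A : ℕ) {μ : ℝ} (h0 : 0 ≤ μ) (h : 2 * μ ≤ 1) :
    μ ≤ |(A : ℝ) - μ| := by
  rcases Nat.eq_zero_or_pos A with rfl | hA
  · simp [abs_of_nonneg h0]
  · have hA1 : (1 : ℝ) ≤ A := by exact_mod_cast hA
    rw [abs_of_nonneg (by linarith)]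
    linarith

/-! ### The remainder of a polynomial sequence beyond `2 ρ_f(m) N` -/

variable (f : ℤ[X])

/-- **Pointwise lower bound.** For the values `f(n)`, `1 ≤ n ≤ N` (`polyAPSeq f N 1 0`, once
`0 < f(n) ≤ x` on the index set) and a modulus `m ≥ 1` with `2 ρ_f(m) N ≤ m`:
`ρ_f(m) N / m ≤ |R_m(x)|`. -/
theorem rootCount_mul_div_le_abs_remainder {N m : ℕ} (hm : 0 < m)
    (hsmall : 2 * ((polyRootCountMod ![f] m : ℝ) * N) ≤ m) {x : ℝ}
    (hx : ∀ n ∈ apIndex N 1 0, 0 < f.eval (n : ℤ) ∧ ((f.eval (n : ℤ) : ℤ) : ℝ) ≤ x) :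
    (polyRootCountMod ![f] m : ℝ) * N / m ≤ |(polyAPSeq f N 1 0).remainder m x| := by
  rw [SieveSequence.remainder, polyAPSeq_congrSum f N 1 0 hx, polyAPSeq_size, polyAPSeq_density,
    rootDensity_apply]
  simp only [Nat.cast_one, div_one]
  have hm' : (0 : ℝ) < m := by exact_mod_cast hm
  have hμ : (polyRootCountMod ![f] m : ℝ) / m * N = (polyRootCountMod ![f] m : ℝ) * N / m := by
    ring
  rw [hμ]
  refine le_abs_natCast_sub _ (by positivity) ?_
  rw [← mul_div_assoc, div_le_one hm']
  exact hsmall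

/-- **Summed lower bound.** Over any finite set `S` of moduli `m ≥ 1` with `2 ρ_f(m) N ≤ m`:
`N · ∑_{m ∈ S} ρ_f(m)/m ≤ ∑_{m ∈ S} |R_m(x)|`. -/
theorem mul_sum_rootCount_div_le_sum_abs_remainder {N : ℕ} (S : Finset ℕ)
    (hS : ∀ m ∈ S, 0 < m ∧ 2 * ((polyRootCountMod ![f] m : ℝ) * N) ≤ m) {x : ℝ}
    (hx : ∀ n ∈ apIndex N 1 0, 0 < f.eval (n : ℤ) ∧ ((f.eval (n : ℤ) : ℤ) : ℝ) ≤ x) :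
    (N : ℝ) * ∑ m ∈ S, (polyRootCountMod ![f] m : ℝ) / m ≤
      ∑ m ∈ S, |(polyAPSeq f N 1 0).remainder m x| := by
  rw [Finset.mul_sum]
  refine Finset.sum_le_sum fun m hm => ?_
  have h := rootCount_mul_div_le_abs_remainder f (hS m hm).1 (hS m hm).2 hx
  calc (N : ℝ) * ((polyRootCountMod ![f] m : ℝ) / m)
      = (polyRootCountMod ![f] m : ℝ) * N / m := by ring
    _ ≤ _ := h

/-! ### The upper half: level `N^{1-ε}` (the tree's remainder bound and first moment) -/

/-- **Upper half (assembled from the tree).** For `f` irreducible of positive degree there is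
`C > 0` with `∑_{1 ≤ m ≤ D} |R_m(x)| ≤ C · D` for all `N`, all `D ≥ 2` and all admissible `x`
(`abs_remainder_polyAPSeq_le`: `|R_m| ≤ ρ_f(m)`; `exists_sum_rootCount_le`: `∑_{m ≤ D} ρ_f(m) ≤ C D`).
In particular the remainder sum up to level `N^{1−ε}` is `O(N^{1−ε}) = o(N)`. -/
theorem sum_abs_remainder_le_linear (hirr : Irreducible f) (hdeg : 0 < f.natDegree) :
    ∃ C : ℝ, 0 < C ∧ ∀ (N : ℕ) (D : ℝ), 2 ≤ D → ∀ x : ℝ,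
      (∀ n ∈ apIndex N 1 0, 0 < f.eval (n : ℤ) ∧ ((f.eval (n : ℤ) : ℤ) : ℝ) ≤ x) →
      ∑ m ∈ Icc 1 ⌊D⌋₊, |(polyAPSeq f N 1 0).remainder m x| ≤ C * D := by
  obtain ⟨C, hC0, hC⟩ := exists_sum_rootCount_le hirr hdeg
  refine ⟨C, hC0, fun N D hD x hx => (Finset.sum_le_sum fun m hm => ?_).trans (hC D hD)⟩
  have hm1 : 0 < m := (Finset.mem_Icc.mp hm).1
  exact abs_remainder_polyAPSeq_le f one_pos hm1 (Nat.coprime_one_left m) hx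

/-! ### Irreducible quadratics: the window `4N < p ≤ V` of prime moduli -/

variable {a b c : ℤ}

/-- The window sum of `ρ_G(p) log p / p` is a difference of two values of `rhoLogSumG`. -/
theorem sum_Ioc_filter_prime_eq {U V : ℕ} (hUV : U ≤ V) :
    ∑ p ∈ (Ioc U V).filter Nat.Prime, (rhoG a b c p : ℝ) * Real.log p / p =
      rhoLogSumG a b c V - rhoLogSumG a b c U := by
  have hsplit : ∀ W : ℕ, rhoLogSumG a b c W =
      ∑ k ∈ Icc 0 W, (if k.Prime then (rhoG a b c k : ℝ) * Real.log k / k else 0) := by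
    intro W
    rw [rhoLogSumG, Nat.floor_natCast, sum_Icc_ite_prime_rhoG_log_div]
  have hIcc : Icc 0 V = Icc 0 U ∪ Ioc U V := by
    ext k
    simp only [Finset.mem_union, Finset.mem_Icc, Finset.mem_Ioc]
    omega
  have hdisj : Disjoint (Icc 0 U) (Ioc U V) :=
    Finset.disjoint_left.mpr fun k hk1 hk2 => by
      rw [Finset.mem_Icc] at hk1
      rw [Finset.mem_Ioc] at hk2
      omega
  rw [hsplit, hsplit, Finset.sum_filter, hIcc, Finset.sum_union hdisj]
  ring

/-- **The window lower bound for an irreducible quadratic.** Let `G = aX² + bX + c` with `a > 0`,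
`c` odd, `G` irreducible, and let `C` bound the error in Mertens' theorem for `ρ_G`
(`|∑_{p ≤ t} ρ_G(p) log p/p − log t| ≤ C`, `t ≥ 1`; the tree's `rhoMertensStrongG`). Then for
`1 ≤ N`, `4N ≤ U ≤ V` and admissible `x`:
`N · (log V − log U − 2C)/log V ≤ ∑_{U < p ≤ V, p prime} |R_p(x)|`
(each such `p` has `ρ_G(p) ≤ 2`, so `2ρ_G(p)N ≤ 4N < p`; and `1/p ≥ (log p/p)/log V`). -/
theorem quadratic_window (ha : 0 < a) (hc : Odd c) (hirr : Irreducible (quadPoly a b c))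
    {C : ℝ} (hC : ∀ t : ℝ, 1 ≤ t → |rhoLogSumG a b c t - Real.log t| ≤ C)
    {N U V : ℕ} (hN : 1 ≤ N) (hU : 4 * N ≤ U) (hUV : U ≤ V) {x : ℝ}
    (hx : ∀ n ∈ apIndex N 1 0, 0 < (quadPoly a b c).eval (n : ℤ) ∧
      (((quadPoly a b c).eval (n : ℤ) : ℤ) : ℝ) ≤ x) :
    (N : ℝ) * ((Real.log V - Real.log U - 2 * C) / Real.log V) ≤
      ∑ p ∈ (Ioc U V).filter Nat.Prime, |(polyAPSeq (quadPoly a b c) N 1 0).remainder p x| := by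
  set S := (Ioc U V).filter Nat.Prime with hSdef
  have hU4 : (4 : ℝ) ≤ U := by
    have : 4 ≤ U := le_trans (by omega) hU
    exact_mod_cast this
  have hV4 : (4 : ℝ) ≤ V := hU4.trans (by exact_mod_cast hUV)
  have hlogV : 0 < Real.log V := Real.log_pos (by linarith)
  -- the moduli of `S` are admissible
  have hS : ∀ m ∈ S, 0 < m ∧ 2 * ((polyRootCountMod ![quadPoly a b c] m : ℝ) * N) ≤ m := by
    intro m hm
    rw [hSdef, Finset.mem_filter, Finset.mem_Ioc] at hm
    obtain ⟨⟨hUm, -⟩, hp⟩ := hm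
    refine ⟨hp.pos, ?_⟩
    have h2 : (polyRootCountMod ![quadPoly a b c] m : ℝ) ≤ 2 := by
      exact_mod_cast rhoG_le_two ha hc hirr hp
    have hm' : (U : ℝ) < m := by exact_mod_cast hUm
    have hN' : (4 : ℝ) * N ≤ U := by exact_mod_cast hU
    have hN0 : (0 : ℝ) ≤ N := Nat.cast_nonneg N
    nlinarith [h2, hm', hN', hN0]
  -- lower bound for `∑_{p ∈ S} ρ_G(p)/p`
  have hsum : (Real.log V - Real.log U - 2 * C) / Real.log V ≤
      ∑ p ∈ S, (polyRootCountMod ![quadPoly a b c] p : ℝ) / p := by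
    rw [div_le_iff₀ hlogV, Finset.sum_mul]
    have hwin := sum_Ioc_filter_prime_eq (a := a) (b := b) (c := c) hUV
    have hV1 : (1 : ℝ) ≤ V := by linarith
    have hU1 : (1 : ℝ) ≤ U := by linarith
    have h1 := (abs_le.mp (hC V hV1)).1
    have h2 := (abs_le.mp (hC U hU1)).2
    calc Real.log V - Real.log U - 2 * C
        ≤ rhoLogSumG a b c V - rhoLogSumG a b c U := by linarith
      _ = ∑ p ∈ S, (rhoG a b c p : ℝ) * Real.log p / p := hwin.symm
      _ ≤ ∑ p ∈ S, (polyRootCountMod ![quadPoly a b c] p : ℝ) / p * Real.log V := by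
          refine Finset.sum_le_sum fun p hp => ?_
          rw [hSdef, Finset.mem_filter, Finset.mem_Ioc] at hp
          obtain ⟨⟨-, hpV⟩, hpp⟩ := hp
          have hp0 : (0 : ℝ) < p := by exact_mod_cast hpp.pos
          have hlogp : Real.log p ≤ Real.log V := Real.log_le_log hp0 (by exact_mod_cast hpV)
          have hρ0 : (0 : ℝ) ≤ (rhoG a b c p : ℝ) := Nat.cast_nonneg _
          calc (rhoG a b c p : ℝ) * Real.log p / p
              ≤ (rhoG a b c p : ℝ) * Real.log V / p :=
                div_le_div_of_nonneg_right (mul_le_mul_of_nonneg_left hlogp hρ0) hp0.le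
            _ = (polyRootCountMod ![quadPoly a b c] p : ℝ) / p * Real.log V := by
                simp only [rhoG, div_mul_eq_mul_div]
  -- combine
  calc (N : ℝ) * ((Real.log V - Real.log U - 2 * C) / Real.log V)
      ≤ (N : ℝ) * ∑ p ∈ S, (polyRootCountMod ![quadPoly a b c] p : ℝ) / p :=
        mul_le_mul_of_nonneg_left hsum (Nat.cast_nonneg N)
    _ ≤ ∑ p ∈ S, |(polyAPSeq (quadPoly a b c) N 1 0).remainder p x| :=
        mul_sum_rootCount_div_le_sum_abs_remainder _ S hS hx

/-- **Headline: the ℓ¹ level of an irreducible quadratic sequence does not exceed `N = x^{1/2}`.**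
For `G = aX² + bX + c` (`a > 0`, `c` odd, `G` irreducible) and every `ε > 0` there is `N₀` with:
for all `N ≥ N₀`, all `V ≥ N^{1+ε}` and all admissible `x`,
`(ε / (2(1+ε))) · N ≤ ∑_{4N < p ≤ V, p prime} |R_p(x)|` — the remainder sum up to level
`N^{1+ε}` is not `o(N)`. -/
theorem quadratic_level_le_half (ha : 0 < a) (hc : Odd c) (hirr : Irreducible (quadPoly a b c))
    {ε : ℝ} (hε : 0 < ε) :
    ∃ N₀ : ℕ, ∀ N : ℕ, N₀ ≤ N → ∀ V : ℕ, (N : ℝ) ^ (1 + ε) ≤ V → ∀ x : ℝ,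
      (∀ n ∈ apIndex N 1 0, 0 < (quadPoly a b c).eval (n : ℤ) ∧
        (((quadPoly a b c).eval (n : ℤ) : ℤ) : ℝ) ≤ x) →
      ε / (2 * (1 + ε)) * N ≤
        ∑ p ∈ (Ioc (4 * N) V).filter Nat.Prime,
          |(polyAPSeq (quadPoly a b c) N 1 0).remainder p x| := by
  obtain ⟨C, hC⟩ := rhoMertensStrongG ha hc hirr
  have hC0 : 0 ≤ C := (abs_nonneg _).trans (hC 1 le_rfl)
  set K : ℝ := Real.log 4 + 2 * C with hK
  have hlog4 : 0 < Real.log 4 := Real.log_pos (by norm_num)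
  have hK0 : 0 < K := by rw [hK]; linarith
  set L : ℝ := 2 * K / ε with hL
  obtain ⟨N₀, hN₀⟩ := exists_nat_ge (Real.exp L + 2)
  refine ⟨N₀, fun N hN V hV x hx => ?_⟩
  have hN₀N : (N₀ : ℝ) ≤ N := by exact_mod_cast hN
  have hexp : 0 < Real.exp L := Real.exp_pos L
  have hN2 : (2 : ℝ) ≤ N := by linarith
  have hNpos : (0 : ℝ) < N := by linarith
  have hN1 : 1 ≤ N := by
    have : (1 : ℝ) ≤ N := by linarith
    exact_mod_cast this
  -- `log N ≥ L`, i.e. `ε log N ≥ 2K`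
  have hlogN : L ≤ Real.log N := by
    rw [← Real.log_exp L]
    exact Real.log_le_log hexp (by linarith)
  have hεA : 2 * K ≤ ε * Real.log N := by
    have := (div_le_iff₀ hε).mp hlogN
    linarith
  have hlogNpos : 0 < Real.log N := Real.log_pos (by linarith)
  -- `log V ≥ (1 + ε) log N`
  have hrpow : 0 < (N : ℝ) ^ (1 + ε) := Real.rpow_pos_of_pos hNpos _
  have hVpos : (0 : ℝ) < V := hrpow.trans_le hV
  have hlogV : (1 + ε) * Real.log N ≤ Real.log V := by
    rw [← Real.log_rpow hNpos]
    exact Real.log_le_log hrpow hV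
  have hlogVpos : 0 < Real.log V := by nlinarith
  -- `4N ≤ V`
  have hU : 4 * N ≤ V := by
    have h4 : (4 : ℝ) ≤ (N : ℝ) ^ ε := by
      rw [← Real.log_le_log_iff (by norm_num) (Real.rpow_pos_of_pos hNpos ε), Real.log_rpow hNpos]
      nlinarith
    have : (4 : ℝ) * N ≤ (N : ℝ) ^ (1 + ε) := by
      rw [Real.rpow_add hNpos, Real.rpow_one]
      nlinarith
    exact_mod_cast this.trans hV
  have hwin := quadratic_window ha hc hirr hC hN1 (le_refl (4 * N)) hU hx
  -- the numerical inequality `ε/(2(1+ε)) ≤ (log V − log(4N) − 2C)/log V`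
  have hlog4N : Real.log ((4 * N : ℕ) : ℝ) = Real.log 4 + Real.log N := by
    push_cast
    exact Real.log_mul (by norm_num) hNpos.ne'
  have key : ε / (2 * (1 + ε)) ≤
      (Real.log V - Real.log ((4 * N : ℕ) : ℝ) - 2 * C) / Real.log V := by
    rw [hlog4N, div_le_div_iff₀ (by positivity) hlogVpos]
    have P1 := mul_nonneg (show (0 : ℝ) ≤ 2 + ε by linarith)
      (show (0 : ℝ) ≤ Real.log V - (1 + ε) * Real.log N by linarith)
    have P2 := mul_nonneg (show (0 : ℝ) ≤ 1 + ε by linarith)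
      (show (0 : ℝ) ≤ ε * Real.log N - 2 * K by linarith)
    rw [hK] at P2
    nlinarith [P1, P2]
  calc ε / (2 * (1 + ε)) * N = (N : ℝ) * (ε / (2 * (1 + ε))) := mul_comm _ _
    _ ≤ (N : ℝ) * ((Real.log V - Real.log ((4 * N : ℕ) : ℝ) - 2 * C) / Real.log V) :=
        mul_le_mul_of_nonneg_left key hNpos.le
    _ ≤ _ := hwin

/-! ### The case `f = X² + 1` -/

/-- `X² + 1` is Iwaniec's `quadPoly 1 0 1`. -/
theorem quadPoly_one_zero_one : quadPoly 1 0 1 = (X ^ 2 + 1 : ℤ[X]) := by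
  simp [quadPoly]

/-- **The sequence `n² + 1`, `1 ≤ n ≤ N`, has ℓ¹ level of distribution at most `N`:** for every
`ε > 0` there is `N₀` such that for all `N ≥ N₀` and all `V ≥ N^{1+ε}`,
`(ε / (2(1+ε))) · N ≤ ∑_{4N < p ≤ V, p prime} |R_p(N² + 1)|`, where
`R_p = #{n ≤ N : p ∣ n² + 1} − ρ(p) N/p` is the remainder of the tree's `polyAPSeq (X² + 1) N 1 0`. -/
theorem X_sq_add_one_level_le_half {ε : ℝ} (hε : 0 < ε) :
    ∃ N₀ : ℕ, ∀ N : ℕ, N₀ ≤ N → ∀ V : ℕ, (N : ℝ) ^ (1 + ε) ≤ V →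
      ε / (2 * (1 + ε)) * N ≤
        ∑ p ∈ (Ioc (4 * N) V).filter Nat.Prime,
          |(polyAPSeq (X ^ 2 + 1 : ℤ[X]) N 1 0).remainder p ((N : ℝ) ^ 2 + 1)| := by
  have hirr : Irreducible (quadPoly 1 0 1) := by
    rw [quadPoly_one_zero_one]; exact irreducible_X_sq_add_one_int
  obtain ⟨N₀, h⟩ := quadratic_level_le_half (a := 1) (b := 0) (c := 1) one_pos odd_one hirr hε
  refine ⟨N₀, fun N hN V hV => ?_⟩
  have hx : ∀ n ∈ apIndex N 1 0, 0 < (quadPoly 1 0 1).eval (n : ℤ) ∧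
      (((quadPoly 1 0 1).eval (n : ℤ) : ℤ) : ℝ) ≤ (N : ℝ) ^ 2 + 1 := by
    intro n hn
    rw [mem_apIndex] at hn
    obtain ⟨⟨-, hnN⟩, -⟩ := hn
    rw [eval_quadPoly]
    refine ⟨by positivity, ?_⟩
    have : (n : ℝ) ≤ N := by exact_mod_cast hnN
    push_cast
    nlinarith
  have h' := h N hN V hV _ hx
  rw [quadPoly_one_zero_one] at h'
  exact h'

end Summit.Parity.BatemanHorn.Theorems.SoloBlindLevel

end
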